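import Literature.NumberTheory.Transcendental.TorsionDichotomy
import HarnessLib

/-!
# Baker's method on `M_κ`: the Semistability Theorem in the stable case

Topic: `Literature/NumberTheory/Transcendental`. Plan item W4 (closing, part 7) of the unit
`provefact-Literature.NumberTheory.Transcendental.H-b596640137`. Call a semistable
`𝔟 ⊊ Lie M_κ` **stable** when no connected algebraic subgroup `0 ≠ K ≠ M_κ` (with `ℚ̄`-data) is
borderline for it, i.e. `dim 𝔟·(n - dim 𝔨) ≠ (dim 𝔟 - dim(𝔟 ∩ 𝔨))·n` for all such `K` — the
analogue of a stable bundle among semistable ones (Baker–Wüstholz, *Logarithmic Forms and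
Diophantine Geometry*, §6.7: the index `τ`). For a stable `𝔟` the two dichotomy theorems close
the Semistability Theorem outright:

* `exists_rational_datum` — for every subgroup datum `K` over `ℂ` (Philippon's obstructions) and a
  `ℚ̄`-rational `𝔟` there is a `ℚ̄`-datum `D` with `dim Lie D = dim Lie K`,
  `dim(𝔟 ∩ Lie K) ≤ dim(𝔟 ∩ Lie D)` (the rational replacement inside `IndexDescent.index_le`, here
  exposed), hence `exists_borderline_rational` — a borderline `ℂ`-datum with `0 ≠ 𝔨 ≠ Lie M_κ`
  yields a borderline `ℚ̄`-datum with `0 ≠ Lie D ≠ Lie M_κ`;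
* `mem_ker_of_stable` — **the Semistability Theorem for stable `𝔟`** (modulo Philippon's zero
  estimate): `w ∈ 𝔟 ∩ AlgTors ⇒ w ∈ ker(exp)`. Proof: `NumCondFamily.dichotomy'` gives a borderline
  obstruction `K` over `ℂ` with a multiple `r·w ∈ Lie K + ker`; by stability `Lie K = 0`, so `r·w`
  is a period; if `w` were not, `TorsionDichotomy.torsionDichotomy` would give a borderline `K₂`
  with `0 ≠ 𝔨₂ ≠ Lie M_κ` — impossible.

The general semistable case reduces to the stable one by induction over quotients and subgroups
(sequel).

## References

* A. Baker, G. Wüstholz, *Logarithmic Forms and Diophantine Geometry*, CUP 2007, §6.7, §6.8.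
-/

noncomputable section

open Module Submodule Complex
open scoped PeriodPair

namespace Literature.NumberTheory.Transcendental

namespace GaGmE

namespace Std

open LiePresentation

variable {β γ δ : Type} [Fintype β] [Fintype γ] [Fintype δ] {κM : δ → γ → Kbar}

/-! ### Rational replacement of Philippon's obstructions -/

variable (κM) in
/-- **Rational replacement.** For a `ℚ̄`-rational `𝔟` and every subgroup datum `K` over `ℂ`
there is a `ℚ̄`-datum `D` (same torus and abelian data, vector data replaced) with
`dim Lie D = dim Lie K` and `dim(𝔟 ∩ Lie K) ≤ dim(𝔟 ∩ Lie D)`.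
[cite: BakerWustholz2007, §6.7 (index and semistability)] -/
theorem exists_rational_datum {𝔟 : Submodule ℂ (β ⊕ (γ ⊕ δ) → ℂ)} (hrat : IsKRational Kbar 𝔟)
    (K : SubgroupDataC β γ δ κM) :
    ∃ D : SubgroupData β γ δ κM, Module.finrank ℂ D.tangent = Module.finrank ℂ K.tangent ∧
      Module.finrank ℂ ↥(𝔟 ⊓ K.tangent) ≤ Module.finrank ℂ ↥(𝔟 ⊓ D.tangent) := by
  -- the players (as in `IndexDescent.index_le`)
  set Θ : Submodule ℂ (δ → ℂ) := dotAnn K.Ξ with hΘ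
  set W₀ : Submodule ℂ (δ → ℂ) := compatSpace κM K.C with hW₀
  set Z : Submodule ℂ (δ → ℂ) := dotAnn W₀ with hZ
  have hΞW₀ : K.Ξ ≤ W₀ := fun ξ hξ => (mem_compatSpace).mpr (K.compat ξ hξ)
  have hZΘ : Z ≤ Θ := dotAnn_anti hΞW₀
  have hZrat : IsKRational Kbar Z := (isKRational_compatSpace K.C).dotAnn Kbar
  set U : Submodule ℂ (δ → ℂ) := (𝔟 ⊓ T₀ K.A K.C).map πs with hU
  have hUrat : IsKRational Kbar U := (hrat.inf Kbar (isKRational_T₀ K.A K.C)).map_funLeft Kbar is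
  obtain ⟨Θ', hΘ'rat, hZΘ', hdimΘ', hdimU⟩ := exists_rational_replacement Kbar hZrat hUrat hZΘ
  -- the `ℚ̄`-datum
  set Ξ' : Submodule ℂ (δ → ℂ) := dotAnn Θ' with hΞ'
  have hΞ'rat : IsKRational Kbar Ξ' := hΘ'rat.dotAnn Kbar
  have hΞ'W₀ : Ξ' ≤ W₀ := by
    have : dotAnn Θ' ≤ dotAnn Z := dotAnn_anti hZΘ'
    rwa [hZ, dotAnn_dotAnn] at this
  let D : SubgroupData β γ δ κM :=
    { A := K.A
      C := K.C
      Ξ := kPoints Kbar Ξ'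
      compat := by
        intro ξ hξ
        have hmem : ofK Kbar ξ ∈ W₀ := hΞ'W₀ hξ
        rw [hW₀, mem_compatSpace, span_C_eq] at hmem
        have e : (fun b => ∑ e, ofK Kbar (L := ℂ) ξ e * (κM e b : ℂ)) =
            ofK Kbar (fun b => ∑ e, ξ e * κM e b) := by
          funext b; simp [ofK, map_sum, map_mul]
        rw [e] at hmem
        have := (mem_kPoints Kbar).mpr hmem
        rwa [kPoints_span_ofK] at this }
  -- the tangent spaces
  have hKt : K.tangent = T₀ K.A K.C ⊓ Θ.comap πs := K.tangent_eq
  have hDt : D.tangent = T₀ K.A K.C ⊓ Θ'.comap πs := by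
    rw [D.tangent_eq]
    show T₀ K.A K.C ⊓ (dotAnn (span ℂ (ofK Kbar '' (kPoints Kbar Ξ' : Set (δ → Kbar))))).comap πs = _
    rw [← hΞ'rat.eq_span_kPoints, hΞ', dotAnn_dotAnn]
  -- dimensions
  have hdimK : Module.finrank ℂ K.tangent = Module.finrank ℂ ↥(T₀ (δ := δ) K.A K.C ⊓ LinearMap.ker πs) +
      Module.finrank ℂ Θ := by rw [hKt, finrank_T₀_inf_comap]
  have hdimD : Module.finrank ℂ D.tangent = Module.finrank ℂ ↥(T₀ (δ := δ) K.A K.C ⊓ LinearMap.ker πs) +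
      Module.finrank ℂ Θ' := by rw [hDt, finrank_T₀_inf_comap]
  have hdimKD : Module.finrank ℂ D.tangent = Module.finrank ℂ K.tangent := by rw [hdimK, hdimD, hdimΘ']
  have hbK : Module.finrank ℂ ↥(𝔟 ⊓ K.tangent) =
      Module.finrank ℂ ↥((𝔟 ⊓ T₀ K.A K.C) ⊓ LinearMap.ker πs) + Module.finrank ℂ ↥(U ⊓ Θ) := by
    rw [hKt, ← inf_assoc, finrank_inf_comap πs (𝔟 ⊓ T₀ K.A K.C) Θ]
  have hbD : Module.finrank ℂ ↥(𝔟 ⊓ D.tangent) =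
      Module.finrank ℂ ↥((𝔟 ⊓ T₀ K.A K.C) ⊓ LinearMap.ker πs) + Module.finrank ℂ ↥(U ⊓ Θ') := by
    rw [hDt, ← inf_assoc, finrank_inf_comap πs (𝔟 ⊓ T₀ K.A K.C) Θ']
  have hbKD : Module.finrank ℂ ↥(𝔟 ⊓ K.tangent) ≤ Module.finrank ℂ ↥(𝔟 ⊓ D.tangent) := by
    rw [hbK, hbD]; exact Nat.add_le_add_left hdimU _
  exact ⟨D, hdimKD, hbKD⟩

variable (κM) in
/-- **A borderline obstruction over `ℂ` with `0 ≠ 𝔨 ≠ Lie M_κ` yields a borderline `ℚ̄`-subgroup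
with `0 ≠ Lie D ≠ Lie M_κ`** (semistable `ℚ̄`-rational `𝔟`). [cite: BakerWustholz2007, §6.7] -/
theorem Semistable.exists_borderline_rational {𝔟 : Submodule ℂ (β ⊕ (γ ⊕ δ) → ℂ)} (hss : Semistable κM 𝔟)
    (hrat : IsKRational Kbar 𝔟) (K : SubgroupDataC β γ δ κM) (hKtop : K.tangent ≠ ⊤) (hKbot : K.tangent ≠ ⊥)
    (hbord : Module.finrank ℂ 𝔟 * (Fintype.card (β ⊕ (γ ⊕ δ)) - Module.finrank ℂ K.tangent) =
      (Module.finrank ℂ 𝔟 - Module.finrank ℂ ↥(𝔟 ⊓ K.tangent)) * Fintype.card (β ⊕ (γ ⊕ δ))) :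
    ∃ D : SubgroupData β γ δ κM, D.tangent ≠ ⊤ ∧ D.tangent ≠ ⊥ ∧
      Module.finrank ℂ 𝔟 * (Fintype.card (β ⊕ (γ ⊕ δ)) - Module.finrank ℂ D.tangent) =
        (Module.finrank ℂ 𝔟 - Module.finrank ℂ ↥(𝔟 ⊓ D.tangent)) * Fintype.card (β ⊕ (γ ⊕ δ)) := by
  obtain ⟨D, hdimKD, hbKD⟩ := exists_rational_datum κM hrat K
  -- `D.tangent ≠ ⊤`, `≠ ⊥`
  have hDtop : D.tangent ≠ ⊤ := by
    intro h
    apply hKtop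
    apply Submodule.eq_top_of_finrank_eq
    have h1 : Module.finrank ℂ D.tangent = Module.finrank ℂ (β ⊕ (γ ⊕ δ) → ℂ) := by rw [h, finrank_top]
    rw [← hdimKD, h1]
  have hDbot : D.tangent ≠ ⊥ := by
    intro h
    apply hKbot
    rw [← Submodule.finrank_eq_zero, ← hdimKD, h, finrank_bot]
  -- semistability for `D` and the borderline equality
  have hssD := hss D.tangent ⟨D, rfl⟩ hDtop
  refine ⟨D, hDtop, hDbot, ?_⟩
  rw [hdimKD] at hssD ⊢
  refine le_antisymm hssD ?_
  calc (Module.finrank ℂ 𝔟 - Module.finrank ℂ ↥(𝔟 ⊓ D.tangent)) * Fintype.card (β ⊕ (γ ⊕ δ))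
      ≤ (Module.finrank ℂ 𝔟 - Module.finrank ℂ ↥(𝔟 ⊓ K.tangent)) * Fintype.card (β ⊕ (γ ⊕ δ)) :=
        Nat.mul_le_mul_right _ (Nat.sub_le_sub_left hbKD _)
    _ = Module.finrank ℂ 𝔟 * (Fintype.card (β ⊕ (γ ⊕ δ)) - Module.finrank ℂ K.tangent) := hbord.symm

/-! ### The stable case -/

variable [DecidableEq γ] [DecidableEq β] [DecidableEq δ]

variable (κM) in
/-- **The Semistability Theorem for a STABLE `𝔟`** (modulo Philippon's zero estimate). Let `Λ`
have algebraic invariants and no CM, `𝔟 ⊊ Lie M_κ` `ℚ̄`-rational and semistable, and assume that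
no connected algebraic subgroup `0 ≠ K ≠ M_κ` (`ℚ̄`-data) is borderline for `𝔟`. Then every
`w ∈ 𝔟` with `exp(w)` algebraic with torsion abelian part lies in `ker(exp)`.
[cite: BakerWustholz2007, Thm. 6.15, §6.8 (pp. 116–119)] -/
theorem mem_ker_of_stable (hphil : philippon1986_std) (L : PeriodPair) (h₂ : IsAlgebraic ℚ L.g₂)
    (h₃ : IsAlgebraic ℚ L.g₃) (hCM : ¬ L.HasCM)
    {𝔟 : Submodule ℂ (β ⊕ (γ ⊕ δ) → ℂ)} (hrat : IsKRational Kbar 𝔟) (h𝔟 : 𝔟 ≠ ⊤)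
    (hss : Semistable κM 𝔟)
    (hst : ∀ D : SubgroupData β γ δ κM, D.tangent ≠ ⊤ → D.tangent ≠ ⊥ →
      Module.finrank ℂ 𝔟 * (Fintype.card (β ⊕ (γ ⊕ δ)) - Module.finrank ℂ D.tangent) ≠
        (Module.finrank ℂ 𝔟 - Module.finrank ℂ ↥(𝔟 ⊓ D.tangent)) * Fintype.card (β ⊕ (γ ⊕ δ)))
    {w : β ⊕ (γ ⊕ δ) → ℂ} (hw𝔟 : w ∈ 𝔟) (hw : w ∈ AlgTors L κM) : w ∈ ker L κM := by
  by_contra hwker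
  -- the first run of Baker's method
  obtain ⟨K, hKtop, hbord, r, hr, hrmem⟩ := BakerData.dichotomy' hphil L h₂ h₃ hCM κM hrat h𝔟 hss hw𝔟 hw
  -- by stability, `Lie K = 0`
  have hKbot : K.tangent = ⊥ := by
    by_contra hKbot
    obtain ⟨D, hDtop, hDbot, hDbord⟩ := hss.exists_borderline_rational κM hrat K hKtop hKbot hbord
    exact hst D hDtop hDbot hDbord
  -- so `r·w` is a period: the torsion case
  have hrw : (r : ℂ) • w ∈ ker L κM := (mem_preimageSubgroup_of_tangent_eq_bot L κM hKbot).mp hrmem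
  obtain ⟨K₂, hK₂top, hK₂bot, hK₂bord⟩ :=
    torsionDichotomy hphil L h₂ h₃ hCM κM hrat h𝔟 hss hw𝔟 hw hr hrw hwker
  obtain ⟨D, hDtop, hDbot, hDbord⟩ := hss.exists_borderline_rational κM hrat K₂ hK₂top hK₂bot hK₂bord
  exact hst D hDtop hDbot hDbord

end Std

end GaGmE

end Literature.NumberTheory.Transcendental

end
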